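import Summits.CriticalPhenomena.PercolationContinuityZ3.Theorems.PercNearOneGluingNoHeavyPcintNawChainZ6C10Defs
import HarnessLib

/-!
# PCINT lane, kernel reduced-state B2c (chain) certificate `Z6C10` (d = 6, memory τ = 10, kc = 4, 798 state classes): row checks 2 (rows [240, 480))

Cell `prim-pcint`, seat `prim-pcint-1` (gen 5); memo `run/shared/lean/prim/pcint/INTERVAL-PLAN.md` §16 ("checker for the reduced-state
automata"; chain bookkeeping REDUCTIONS §B2c).  Does NOT build on p205010.  Data for `NawK.le_siteCriticalProb_of_checkRowsC` (`…PcintNawChainMemKernelCert`):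
`p = 10090/100000`, `q̄ = 99118/100000` (`q̄^12·100000^12 ≥ (100000-10090)·100000^11`), `λ = 99999/100000`; Collatz–Wielandt weights (scale 10⁹) from a
power iteration, exact off-line max row ratio 0.9993576006 < λ.  Generated by gen5/gen_lean.py (pcint-1 folder); the kernel re-checks every row.
-/

namespace Summit.CriticalPhenomena.PercolationContinuityZ3.Theorems.Pcint.NawChainZ6C10

set_option maxHeartbeats 0 in
/-- Rows `[240, 320)` pass the check. [folklore] -/
theorem chk_240 : WinK.allRange (NawK.checkRowC 10 4 6 798 10090 99118 100000 99999 100000 NawChainZ6C10.syms NawChainZ6C10.tree) 240 320 = true :=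
  WinK.allRange_of_allRangeB (fuel := 8) (lo := 240) (len := 80) (by decide +kernel)

set_option maxHeartbeats 0 in
/-- Rows `[320, 400)` pass the check. [folklore] -/
theorem chk_320 : WinK.allRange (NawK.checkRowC 10 4 6 798 10090 99118 100000 99999 100000 NawChainZ6C10.syms NawChainZ6C10.tree) 320 400 = true :=
  WinK.allRange_of_allRangeB (fuel := 8) (lo := 320) (len := 80) (by decide +kernel)

set_option maxHeartbeats 0 in
/-- Rows `[400, 480)` pass the check. [folklore] -/
theorem chk_400 : WinK.allRange (NawK.checkRowC 10 4 6 798 10090 99118 100000 99999 100000 NawChainZ6C10.syms NawChainZ6C10.tree) 400 480 = true :=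
  WinK.allRange_of_allRangeB (fuel := 8) (lo := 400) (len := 80) (by decide +kernel)

/-- Rows `[240, 480)` pass the check. [folklore] -/
theorem file_2 : WinK.allRange (NawK.checkRowC 10 4 6 798 10090 99118 100000 99999 100000 NawChainZ6C10.syms NawChainZ6C10.tree) 240 480 = true := (WinK.allRange_split (WinK.allRange_split chk_240 chk_320) chk_400)

end Summit.CriticalPhenomena.PercolationContinuityZ3.Theorems.Pcint.NawChainZ6C10
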